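/-
Copyright (c) 2026 the pub-hodgecm-mathlib formalisation cell (harness21).  Prover seat hodgecm-mathlib-LH4-p05 (g4), req620 Track A «(D-RAM) FOUR-FRAME» squad F0∕P3c∕LH4,
unit (ii-H), leaf (ρ2b′-X): bottom (A) organ «GAP-R» named by LH4-p11 (g5) (06:41Z) — a NONEMPTY depth cell sits inside the tube bound.  2026-09-04.
-/
import Summits.HodgeConjecture.HodgeConjecture.Theorems.F0P3cDyRamConeWeightHalfSplit   -- ★ (β) p857610: the flip (`cell_clauses_map_mulLeft`), `#Sol(r) + #Sol(r∕ξ) = 2q^b`; brings ★ cone transport, ★ per-cell fibre count, DEFS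
import Summits.HodgeConjecture.HodgeConjecture.Theorems.F0P3cDyRamBlockGluePlane        -- ★ p857479 (LH4-p07): `mapGL_eq_of_comap_planeMatrix_mem_coneIndex`, `planeMatrix_injective`
import HarnessLib

/-!
# Crux `H413`, line LH4 «(D-RAM) FOUR-FRAME» — leaf (ρ2b′-X), bottom (A) organ «GAP-R»: A NONEMPTY DEPTH CELL `levelSetDep(j, b; lam − jE u)` HAS `b ≤ R`

Cell `hodgecm-mathlib` (D-0151), FLOOR 0, crux item H413 = `stmt-HodgeConjecture-24833`, route of record `HCCMUnconditional`; squad F0∕P3c∕LH4.  THEOREMS ONLY (no `def`,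
no instance, no notation, no named fact, no `sorry`, default heartbeats); lane `--supports stmt-HodgeConjecture-24833 --as helper` (count-neutral).

WHY.  ★ (C1) `F0P3cDyRamBlockCensusOrderForm.ncard_fixed_selfDual_endoGL_eq_orderForm` sums the cone layers over `b ∈ Icc 1 R`, `R` being ANY bound on the tube coordinates of the
`Γ`-fixed self-dual lattices (`hR`), while the toric re-indexing ★ `F0P3cDyRamToricCensusSumUnrReindex.orderCounts_eq_censusSum_unr` wants the range `Icc 1 (jl + 1)`; bottom (A)
(LH4-p11 (g5)) re-indexes to `Icc 1 (max R (jl + 1))`, which is legitimate once every cell with `b > R` is EMPTY — this file.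

WHAT IS PROVED (frame = ★ (β) `finsum_levelSetDep_weight_eq_pow_mul_ncard`'s letters VERBATIM — plane `(E², H₂)`, line model `(M, jE, ρ, Θ, α; φ, lam, h)`, wild datum, flip unit
`(z, ξ)` — plus ★ (C1)'s block letters `hH₂`, `u : GL (Fin 1) E`, `hΓ`, `hu`, `hR`):
* `le_of_cell_of_natCard_normFibre_pos` — a PRESENTED cone cell (`x₀`, clauses of `levelSetDep(j, b; lam − jE u₀₀)`, `lam ∈ 𝒪_j`) whose glue-norm residue count
  `#Sol_{2b}(r)` (`jE r = glueUnit(x₀, b)`) is POSITIVE lies in the tube bound: `b ≤ R`.  (★ `exists_coneData_of_gen` gives the cone plane lattice `B₂`; ★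
  `ncard_glueFibre_eq_natCard_normFibre_of_gen` makes the glue fibre over `B₂` non-empty; any member is a self-dual lattice with tube coordinate `b` and plane part `B₂`, hence
  `Γ`-FIXED by ★ `mapGL_eq_of_comap_planeMatrix_mem_coneIndex`; `hR` bounds it.)
* **`le_of_levelSetDep_nonempty`** — if `levelSetDep(j, b; lam − jE u₀₀)` is non-empty (`b ≥ 1`, `lam ∈ 𝒪_j`) then `b ≤ R`: for a cell `Λ` and its flip `z·Λ` (★ (β)
  `cell_clauses_map_mulLeft`, glue units `r₀` and `r₀ ∕ ξ`), `#Sol_{2b}(r₀) + #Sol_{2b}(r₀ ∕ ξ) = 2q^b > 0` (★ (β) `natCard_normFibre_add_natCard_normFibre_div_eq`), so one of the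
  two presented cells has a positive count and the first bullet applies.
HONEST LABEL: HC_CM is proved only modulo the 7 printed citations (2 remaining named inputs: hLiu418 = stmt-HodgeConjecture-24832, h413 = stmt-HodgeConjecture-24833) until rung 0
closes; (ρ2b′-X) stays an OPEN prover target; helper (`--supports`), proofs only, pure composition of ★ organs.

## References
* [Kottwitz1986BaseChangeUnits] R. E. Kottwitz, *Base change for unit elements of Hecke algebras*, Compositio Math. 60 (1986), §1 pp. 240–241 (fixed self-dual lattices of a
  unitary element), §3 pp. 247–249 (Levi blocks).
* [BruhatTits1972] F. Bruhat, J. Tits, *Groupes réductifs sur un corps local I*, Publ. Math. IHÉS 41 (1972), §10 (tube layers of the rank-one building).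
* [Jacobowitz1962] R. Jacobowitz, *Hermitian forms over local fields*, Amer. J. Math. 84 (1962), §4 (dual lattices, gluing).
* [Serre1979] J.-P. Serre, *Local Fields*, GTM 67 (1979), Ch. V §3 Prop. 5, Cor. 2–3 pp. 84–86 (norm residues of a ramified quadratic extension).
-/

set_option autoImplicit false

noncomputable section

open scoped Valued WithZero Matrix MatrixGroups
open WithZero
open scoped Classical
open Literature.NumberTheory.Automorphic Literature.NumberTheory.Automorphic.HermitianLattice Literature.NumberTheory.Automorphic.UnitaryLatticeTree
open Literature.NumberTheory.Automorphic.UnitaryThreeFourFrame (IsRamifiedQuadraticDatum)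
open Literature.NumberTheory.Automorphic.EllipticPlaneAsFieldLine
open Literature.NumberTheory.Rogawski1990
open Literature.NumberTheory.LocalFields.QuadraticOrder
open Literature.NumberTheory.LocalFields.WildQuadraticDatum
open Summit.HodgeConjecture.HodgeConjecture.Cruxes.H413.F0P3cDyRamToricCensusDefs
open Summit.HodgeConjecture.HodgeConjecture.Cruxes.H413.F0P3cDyRamConeLevelTransport
open Summit.HodgeConjecture.HodgeConjecture.Cruxes.H413.F0P3cDyRamConeWeightHalfSplit
open Summit.HodgeConjecture.HodgeConjecture.Cruxes.H413.F0P3cDyRamBlockGluePlane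

namespace Summit.HodgeConjecture.HodgeConjecture.Cruxes.H413.F0P3cDyRamConeTubeBound

variable {E : Type} {M : Type*} [Field E] [Valued E ℤᵐ⁰] [Field M] [Valued M ℤᵐ⁰] {ρ Θ : M →+* M} {α : M}

/-- **A PRESENTED CONE CELL WITH A POSITIVE GLUE COUNT LIES IN THE TUBE BOUND.**  Block frame of ★ (C1) (`hH₂`, `hΓ`, `hu`, `hR`) + line model; a presented cell `Λ = x₀·𝒪_j`
with the `levelSetDep(j, b; lam − jE u₀₀)` clauses, `lam ∈ 𝒪_j`, glue unit `jE r`, and `0 < #Sol_{2b}(r)`: then `b ≤ R` — the glue fibre over its cone plane lattice is non-empty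
and consists of `Γ`-fixed self-dual lattices with tube coordinate `b`. [cite: Kottwitz1986BaseChangeUnits, §1 pp. 240–241] [cite: BruhatTits1972, §10] [cite: Jacobowitz1962, §4] -/
theorem le_of_cell_of_natCard_normFibre_pos [IsPrincipalIdealRing 𝒪[E]] (σ : E →+* E) (hσ : ∀ a, σ (σ a) = a) (hvσ : ∀ a, Valued.v (σ a) = Valued.v a)
    {ϖ : E} (hϖ : Valued.v ϖ = WithZero.exp (-1 : ℤ))
    {H₂ : Matrix (Fin 2) (Fin 2) E} (hH₂ : IsUnit H₂.det) (hH₂σ : (H₂.map σ)ᵀ = H₂) {hW : E} (hhW : Valued.v hW = 1) (hhWσ : σ hW = hW) (jE : E →+* M)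
    (hρρ : ∀ x, ρ (ρ x) = x) (hvρ : ∀ x, Valued.v (ρ x) = Valued.v x) (hα : ρ α ≠ α) (hα1 : Valued.v α ≤ 1)
    (hint : ∀ z : M, Valued.v z ≤ 1 → Valued.v ((z - ρ z) / (α - ρ α)) ≤ 1)
    (hΘΘ : ∀ x, Θ (Θ x) = x) (hΘρ : ∀ x, Θ (ρ x) = ρ (Θ x)) (hvΘ : ∀ x, Valued.v (Θ x) = Valued.v x) (hΘj : ∀ x, Θ (jE x) = jE (σ x))
    (hjv : ∀ c, Valued.v (jE c) ≤ 1 ↔ Valued.v c ≤ 1) (hjfix : ∀ z, ρ z = z ↔ ∃ c, jE c = z)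
    (hjpow : ∀ (t : E) (n : ℤ), Valued.v (jE t) = Valued.v (jE ϖ) ^ n ↔ Valued.v t = Valued.v ϖ ^ n)
    (hϖmax : ∀ t : M, ρ t = t → Valued.v t < 1 → Valued.v t ≤ Valued.v (jE ϖ))
    (φ : (Fin 2 → E) →+ M) (hφs : ∀ (c : E) (x : Fin 2 → E), φ (c • x) = jE c * φ x) (hφi : Function.Injective φ) (hφo : Function.Surjective φ)
    {γ₂ : GL (Fin 2) E} {lam h : M} (hφγ : ∀ x, φ ((γ₂ : Matrix (Fin 2) (Fin 2) E).mulVec x) = lam * φ x) (hlam : Valued.v lam = 1)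
    (hΘh : Θ h = h) (hh : h ≠ 0) (hform : ∀ x y, jE (pairing σ H₂ x y) = h * Θ (φ x) * φ y + ρ (h * Θ (φ x) * φ y))
    (u : GL (Fin 1) E) (hΓ : endoGL (γ₂, u) ∈ unitaryGroupOfForm σ (!![H₂ 0 0, 0, H₂ 0 1; 0, hW, 0; H₂ 1 0, 0, H₂ 1 1] : Matrix (Fin 3) (Fin 3) E))
    (hu : Valued.v ((u : Matrix (Fin 1) (Fin 1) E) 0 0) = 1) {R : ℕ}
    (hR : ∀ L : Submodule 𝒪[E] (Fin 3 → E), IsSelfDualLattice σ ϖ (!![H₂ 0 0, 0, H₂ 0 1; 0, hW, 0; H₂ 1 0, 0, H₂ 1 1] : Matrix (Fin 3) (Fin 3) E) L →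
      mapGL (endoGL (γ₂, u)) L = L → ∀ b : ℕ, (∀ c : E, (Pi.single 1 c : Fin 3 → E) ∈ L ↔ Valued.v c ≤ Valued.v ϖ ^ b) → b ≤ R)
    {b : ℕ} (hb : 1 ≤ b) {j : ℕ} {Λ : AddSubgroup M} {x₀ : M} (hx₀ : x₀ ≠ 0)
    (hΛx : ∀ x, x ∈ Λ ↔ ∃ z, IsOrd ρ α (jE ϖ ^ j) z ∧ x = x₀ * z) (hyO : IsOrd ρ α (jE ϖ ^ j) (dualGen ρ Θ α (jE ϖ ^ j) h x₀))
    (hyprim : ¬ IsOrd ρ α (jE ϖ ^ j) (dualGen ρ Θ α (jE ϖ ^ j) h x₀ / jE ϖ)) (hylev : Valued.v (dualGen ρ Θ α (jE ϖ ^ j) h x₀) = Valued.v (jE ϖ) ^ b)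
    (hdepΛ : ∀ b', (∀ x ∈ Λ, Valued.v (h * Θ x * b' + ρ (h * Θ x * b')) ≤ 1) → (lam - jE ((u : Matrix (Fin 1) (Fin 1) E) 0 0)) * b' ∈ Λ)
    (hlamj : IsOrd ρ α (jE ϖ ^ j) lam) {r : E} (hr : jE r = glueUnit ρ Θ α (jE ϖ ^ j) h (jE ϖ) (jE hW) x₀ b)
    (hpos : 0 < Nat.card {x : 𝒪[E] ⧸ 𝓂[E] ^ (2 * b) // ∃ u' : 𝒪[E], Ideal.Quotient.mk (𝓂[E] ^ (2 * b)) u' = x ∧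
      Valued.v ((u' : E) * σ u' - r) ≤ Valued.v (ϖ ^ (2 * b))}) :
    b ≤ R := by
  have hvϖ0 : Valued.v ϖ ≠ 0 := by rw [hϖ]; exact WithZero.exp_ne_zero
  have hϖ0 : ϖ ≠ 0 := fun h0 => by rw [h0, map_zero] at hvϖ0; exact hvϖ0 rfl
  have hϖ1 : Valued.v ϖ < 1 := by rw [hϖ, ← WithZero.exp_zero, WithZero.exp_lt_exp]; norm_num
  -- the cone plane lattice of the cell
  obtain ⟨B, hBΛ, hBlatt, hBfix, w₀, -, hG1, hgen, hnorm, hdepB⟩ := exists_coneData_of_gen σ hϖ0 hϖ1 H₂ jE hρρ hvρ hα hα1 hint hΘΘ hΘρ hvΘ hjv hjfix hjpow hϖmax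
    φ hφs hφi hφo hφγ hlam hΘh hh hform ((u : Matrix (Fin 1) (Fin 1) E) 0 0) hb hx₀ hΛx hyO hyprim hylev hdepΛ hlamj
  -- its glue fibre has `#Sol_{2b}(r) > 0` members
  have hcount := ncard_glueFibre_eq_natCard_normFibre_of_gen σ hσ hvσ hϖ hH₂ hH₂σ hhW hhWσ jE hρρ hvρ hα hα1 hint hΘΘ hΘρ hvΘ hΘj hjv hjfix hjpow hϖmax
    φ hφs hφi hφo hφγ hlam hΘh hh hform ((u : Matrix (Fin 1) (Fin 1) E) 0 0) hb (B₂ := B) hx₀ (by rw [hBΛ]; exact hΛx) hyO hyprim hylev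
    (by rw [hBΛ]; exact hdepΛ) hlamj hr
  obtain ⟨L, hLSD, hLW, hLtube⟩ := Set.nonempty_of_ncard_ne_zero (s := {L : Submodule 𝒪[E] (Fin 3 → E) |
      IsSelfDualLattice σ ϖ (!![H₂ 0 0, 0, H₂ 0 1; 0, hW, 0; H₂ 1 0, 0, H₂ 1 1] : Matrix (Fin 3) (Fin 3) E) L ∧
        L ⊓ LinearMap.ker ((LinearMap.proj (1 : Fin 3) : (Fin 3 → E) →ₗ[E] E).restrictScalars 𝒪[E]) =
          B.map ((Matrix.toLin' (!![1, 0; 0, 0; 0, 1] : Matrix (Fin 3) (Fin 2) E)).restrictScalars 𝒪[E]) ∧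
        ∀ c : E, (Pi.single 1 c : Fin 3 → E) ∈ L ↔ Valued.v c ≤ Valued.v ϖ ^ b}) (by rw [hcount]; exact hpos.ne')
  -- any member is `Γ`-fixed (its plane part is the cone plane lattice `B`), so `hR` bounds its tube coordinate
  have hκ : (L ⊓ LinearMap.ker ((LinearMap.proj (1 : Fin 3) : (Fin 3 → E) →ₗ[E] E).restrictScalars 𝒪[E])).comap
      ((Matrix.toLin' (!![1, 0; 0, 0; 0, 1] : Matrix (Fin 3) (Fin 2) E)).restrictScalars 𝒪[E]) = B := by
    rw [hLW, Submodule.comap_map_eq_of_injective planeMatrix_injective]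
  have hfix : mapGL (endoGL (γ₂, u)) L = L :=
    mapGL_eq_of_comap_planeMatrix_mem_coneIndex σ hσ hvσ hϖ hH₂ hH₂σ hhW hLSD hb hLtube γ₂ u hΓ hu
      (by rw [hκ]; exact ⟨hBlatt, hBfix, w₀, hG1, hgen, hnorm, hdepB⟩)
  exact hR L hLSD hfix b hLtube

/-- **GAP-R: A NONEMPTY DEPTH CELL LIES IN THE TUBE BOUND.**  Frame of ★ (β) `finsum_levelSetDep_weight_eq_pow_mul_ncard` (plane, line model, wild datum `IsRamifiedQuadraticDatum σ ϖ d t`,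
`|2| < 1`, flip unit `z` with `z·Θz = jE ξ`, `ξ` a `σ`-fixed NON-NORM) + ★ (C1)'s block letters (`hH₂`, `u : GL (Fin 1) E`, `hΓ`, `hu`, `hR`).  If `levelSetDep(j, b; lam − jE u₀₀)` is
non-empty with `b ≥ 1` and `lam ∈ 𝒪_j`, then `b ≤ R`: of a cell `Λ` and its flip `z·Λ` (glue units `r₀`, `r₀ ∕ ξ`, `#Sol_{2b}(r₀) + #Sol_{2b}(r₀ ∕ ξ) = 2q^b > 0`) one has a positive
glue count, and `le_of_cell_of_natCard_normFibre_pos` applies.  So the cells with `b > R` are EMPTY and ★ (C1)'s `Σ_{b ∈ Icc 1 R}` may be re-indexed over any larger range.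
[cite: Kottwitz1986BaseChangeUnits, §1 pp. 240–241] [cite: Serre1979, Ch. V §3 Prop. 5, Cor. 2–3 pp. 84–86] [cite: Jacobowitz1962, §4] -/
theorem le_of_levelSetDep_nonempty [CompleteSpace E] [IsDiscreteValuationRing 𝒪[E]] [Finite 𝓀[E]]
    (σ : E →+* E) (hσ : ∀ a, σ (σ a) = a) (hvσ : ∀ a, Valued.v (σ a) = Valued.v a)
    {ϖ : E} (hϖ : Valued.v ϖ = WithZero.exp (-1 : ℤ)) {d t : ℕ} (hD : IsRamifiedQuadraticDatum σ ϖ d t) (h2v : Valued.v (2 : E) < 1)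
    {H₂ : Matrix (Fin 2) (Fin 2) E} (hH₂ : IsUnit H₂.det) (hH₂σ : (H₂.map σ)ᵀ = H₂) {hW : E} (hhW : Valued.v hW = 1) (hhWσ : σ hW = hW) (jE : E →+* M)
    (hρρ : ∀ x, ρ (ρ x) = x) (hvρ : ∀ x, Valued.v (ρ x) = Valued.v x) (hα : ρ α ≠ α) (hα1 : Valued.v α ≤ 1)
    (hint : ∀ z : M, Valued.v z ≤ 1 → Valued.v ((z - ρ z) / (α - ρ α)) ≤ 1)
    (hΘΘ : ∀ x, Θ (Θ x) = x) (hΘρ : ∀ x, Θ (ρ x) = ρ (Θ x)) (hvΘ : ∀ x, Valued.v (Θ x) = Valued.v x) (hΘj : ∀ x, Θ (jE x) = jE (σ x))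
    (hjv : ∀ c, Valued.v (jE c) ≤ 1 ↔ Valued.v c ≤ 1) (hjfix : ∀ z, ρ z = z ↔ ∃ c, jE c = z)
    (hjpow : ∀ (t : E) (n : ℤ), Valued.v (jE t) = Valued.v (jE ϖ) ^ n ↔ Valued.v t = Valued.v ϖ ^ n)
    (hϖmax : ∀ t : M, ρ t = t → Valued.v t < 1 → Valued.v t ≤ Valued.v (jE ϖ))
    (φ : (Fin 2 → E) →+ M) (hφs : ∀ (c : E) (x : Fin 2 → E), φ (c • x) = jE c * φ x) (hφi : Function.Injective φ) (hφo : Function.Surjective φ)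
    {γ₂ : GL (Fin 2) E} {lam h : M} (hφγ : ∀ x, φ ((γ₂ : Matrix (Fin 2) (Fin 2) E).mulVec x) = lam * φ x) (hlam : Valued.v lam = 1)
    (hΘh : Θ h = h) (hh : h ≠ 0) (hform : ∀ x y, jE (pairing σ H₂ x y) = h * Θ (φ x) * φ y + ρ (h * Θ (φ x) * φ y))
    (z : M) (hz1 : Valued.v z = 1) (ξ : E) (hzξ : z * Θ z = jE ξ) (hσξ : σ ξ = ξ) (hξN : ¬ ∃ e : E, e * σ e = ξ)
    (u : GL (Fin 1) E) (hΓ : endoGL (γ₂, u) ∈ unitaryGroupOfForm σ (!![H₂ 0 0, 0, H₂ 0 1; 0, hW, 0; H₂ 1 0, 0, H₂ 1 1] : Matrix (Fin 3) (Fin 3) E))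
    (hu : Valued.v ((u : Matrix (Fin 1) (Fin 1) E) 0 0) = 1) {R : ℕ}
    (hR : ∀ L : Submodule 𝒪[E] (Fin 3 → E), IsSelfDualLattice σ ϖ (!![H₂ 0 0, 0, H₂ 0 1; 0, hW, 0; H₂ 1 0, 0, H₂ 1 1] : Matrix (Fin 3) (Fin 3) E) L →
      mapGL (endoGL (γ₂, u)) L = L → ∀ b : ℕ, (∀ c : E, (Pi.single 1 c : Fin 3 → E) ∈ L ↔ Valued.v c ≤ Valued.v ϖ ^ b) → b ≤ R)
    {b : ℕ} (hb : 1 ≤ b) {j : ℕ} (hlamj : IsOrd ρ α (jE ϖ ^ j) lam)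
    (hne : (levelSetDep ρ Θ α (jE ϖ) h j b (lam - jE ((u : Matrix (Fin 1) (Fin 1) E) 0 0))).Nonempty) :
    b ≤ R := by
  have hvϖ0 : Valued.v ϖ ≠ 0 := by rw [hϖ]; exact WithZero.exp_ne_zero
  have hϖ0 : ϖ ≠ 0 := fun h0 => by rw [h0, map_zero] at hvϖ0; exact hvϖ0 rfl
  have hϖ1 : Valued.v ϖ < 1 := by rw [hϖ, ← WithZero.exp_zero, WithZero.exp_lt_exp]; norm_num
  set u₀ : E := (u : Matrix (Fin 1) (Fin 1) E) 0 0 with hu₀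
  set ϖE : M := jE ϖ with hϖE
  set c : M := ϖE ^ j with hcdef
  have hρϖ : ρ ϖE = ϖE := (hjfix ϖE).2 ⟨ϖ, rfl⟩
  have hϖE0 : ϖE ≠ 0 := (map_ne_zero jE).2 hϖ0
  have hϖE1 : Valued.v ϖE < 1 := by
    refine lt_of_le_of_ne ((hjv ϖ).2 hϖ1.le) fun hle => ?_
    have := (hjpow ϖ 0).1 (by rw [zpow_zero]; exact hle)
    rw [zpow_zero] at this
    exact hϖ1.ne this
  have hc : ρ c = c := by rw [hcdef, map_pow, hρϖ]
  have hc0 : c ≠ 0 := pow_ne_zero j hϖE0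
  have hc1 : Valued.v c ≤ 1 := by rw [hcdef, map_pow]; exact pow_le_one₀ zero_le hϖE1.le
  have hd0 : α - ρ α ≠ 0 := sub_ne_zero.2 (Ne.symm hα)
  -- the flip unit
  set ξ' : M := jE ξ with hξ'def
  have hρξ' : ρ ξ' = ξ' := (hjfix ξ').2 ⟨ξ, rfl⟩
  have hξ'1 : Valued.v ξ' = 1 := by rw [← hzξ, map_mul, hvΘ, hz1, one_mul]
  have hξ'0 : ξ' ≠ 0 := fun h0 => by rw [h0, map_zero] at hξ'1; exact zero_ne_one hξ'1
  have hξ1 : Valued.v ξ = 1 := by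
    have := (hjpow ξ 0).1 (by rw [zpow_zero]; exact hξ'1)
    rwa [zpow_zero] at this
  have hz0 : z ≠ 0 := fun h0 => by rw [h0, map_zero] at hz1; exact zero_ne_one hz1
  -- the hermitian symmetry of `H₂`
  have hH : ∀ a b', σ (H₂ a b') = H₂ b' a := by
    intro a b'
    have := congrFun (congrFun hH₂σ b') a
    simpa [Matrix.transpose_apply, Matrix.map_apply] using this
  -- a presented cell, its canonical glue unit `r₀`, and the flipped cell with glue unit `r₀ ∕ ξ`
  obtain ⟨Λ, hΛ⟩ := hne
  obtain ⟨⟨x₀, hx₀, hΛx, hyO, hyprim, hylev⟩, hdepΛ⟩ := hΛ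
  obtain ⟨B', -, -, -, w₀, hw₀Y, -, -, hw₀, -⟩ := exists_coneData_of_gen σ hϖ0 hϖ1 H₂ jE hρρ hvρ hα hα1 hint hΘΘ hΘρ hvΘ hjv hjfix hjpow hϖmax
    φ hφs hφi hφo hφγ hlam hΘh hh hform u₀ hb hx₀ hΛx hyO hyprim hylev hdepΛ hlamj
  set r₀ : E := -(pairing σ H₂ w₀ w₀) * (ϖ ^ b * σ (ϖ ^ b)) / hW with hr₀def
  have hr₀ : jE r₀ = glueUnit ρ Θ α c h ϖE (jE hW) x₀ b := map_glueNorm_eq σ H₂ jE hΘj φ hform hw₀Y ϖ hW b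
  have hpair₀ : σ (pairing σ H₂ w₀ w₀) = pairing σ H₂ w₀ w₀ := (pairing_comm_of_hermitian hσ hH w₀ w₀).symm
  have hσr₀ : σ r₀ = r₀ := by
    rw [hr₀def, map_div₀, map_mul, map_neg, hpair₀, map_mul, hσ, hhWσ, mul_comm (σ (ϖ ^ b)) (ϖ ^ b)]
  have hr₀1 : Valued.v r₀ = 1 := by
    rw [hr₀def, map_div₀, map_mul, Valuation.map_neg, map_mul, hvσ, map_pow, hhW, div_one, ← pow_add, ← two_mul]
    exact hw₀
  obtain ⟨hzx₀, hΛ'x, hyO', hyprim', hylev', hdep'⟩ :=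
    cell_clauses_map_mulLeft hρρ hvρ hα hα1 hint hΘΘ hΘρ hvΘ hc hc0 hc1 hh hz0 hzξ hρξ' hξ'1 ϖE (lam - jE u₀) b hx₀ hΛx hyO hyprim hylev hdepΛ
  have hY0 : dualGen ρ Θ α c h x₀ ≠ 0 := by
    rw [dualGen_def]
    exact mul_ne_zero (mul_ne_zero hh (mul_ne_zero hx₀ ((map_ne_zero Θ).2 hx₀))) (mul_ne_zero hc0 hd0)
  have hr₀' : jE (r₀ / ξ) = glueUnit ρ Θ α c h ϖE (jE hW) (z * x₀) b := by
    rw [map_div₀, hr₀, glueUnit_mul_left hΘΘ hzξ hρξ' hξ'0 hY0]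
  -- one of the two glue counts is positive
  have hsum := natCard_normFibre_add_natCard_normFibre_div_eq hD h2v hσr₀ hr₀1 hσξ hξ1 hξN hb
  have hq0 : 0 < 2 * Nat.card 𝓀[E] ^ b := Nat.mul_pos two_pos (pow_pos Nat.card_pos b)
  rcases Nat.eq_zero_or_pos (Nat.card {x : 𝒪[E] ⧸ 𝓂[E] ^ (2 * b) // ∃ u' : 𝒪[E], Ideal.Quotient.mk (𝓂[E] ^ (2 * b)) u' = x ∧
      Valued.v ((u' : E) * σ u' - r₀) ≤ Valued.v (ϖ ^ (2 * b))}) with h0 | hpos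
  · rw [h0, zero_add] at hsum
    exact le_of_cell_of_natCard_normFibre_pos σ hσ hvσ hϖ hH₂ hH₂σ hhW hhWσ jE hρρ hvρ hα hα1 hint hΘΘ hΘρ hvΘ hΘj hjv hjfix hjpow hϖmax φ hφs hφi hφo
      hφγ hlam hΘh hh hform u hΓ hu hR hb hzx₀ hΛ'x hyO' hyprim' hylev' hdep' hlamj hr₀' (by rw [hsum]; exact hq0)
  · exact le_of_cell_of_natCard_normFibre_pos σ hσ hvσ hϖ hH₂ hH₂σ hhW hhWσ jE hρρ hvρ hα hα1 hint hΘΘ hΘρ hvΘ hΘj hjv hjfix hjpow hϖmax φ hφs hφi hφo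
      hφγ hlam hΘh hh hform u hΓ hu hR hb hx₀ hΛx hyO hyprim hylev hdepΛ hlamj hr₀ hpos

end Summit.HodgeConjecture.HodgeConjecture.Cruxes.H413.F0P3cDyRamConeTubeBound

end
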